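import Summits.BirchSwinnertonDyer.BirchSwinnertonDyer.Theorems.AdditiveBranchIMCGordTwoRankOneWanAnyRoadField
import HarnessLib

/-!
# The dyadic Wan road, file 2/5 `Flat`: read R1 DISCHARGED — the ♭-inclusion chain over `TameRoadFieldAny`
# (p761092 §`TwistRowClosed` re-keyed; ONE chain for every Wan prime, the semistable partner chosen by the parity of the Wan prime)

* `awayFromCyc_wanAny`, `greenbergInclusion_wanAny`, `flatInclusion_wanAny` — `TwistRowClosed.{awayFromCyc,greenbergInclusion,flatInclusion}_twistAny`
  re-keyed over `TameRoadFieldAny`; at `q = 2` the curve is multiplicative at `2`, so the partner comes from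
  `TwistTypePartnerData.exists_semistable_partner_data_odd` (`d ≡ 1 (mod 4)`, CLW's `hd4` vacuous, `h2V := q ∣ N_V`).

PROVENANCE: this is the pen's CHECKED, SORRY-FREE port `Cruxes/GordTwoRankOne/WanAnyRoadPort.lean` v1 (planner bsd-addord-plan g44, E354, crux commit
8edfc766c5d5, sha256 8cb68225fc3c8710, lean check rc 0 / 0 sorries), landed Theorems-side by seat prover-bsd-addord-stub-1-g0 per the recipe e18 §5 (director-bsd
(587)(B)); namespace `…Cruxes.GordTwoRankOne.WanTameBdpRoad.Port` ↦ `…Theorems.WanAnyRoad`, vocabulary from `AdditiveBranchIMCGordTwoRankOneWanAnyRoadDefs`, split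
into ≤ 400-line files (`…WanAnyRoad{Field,Flat,Socket,StepL,ClosedHL}`); proofs byte-identical otherwise. BSD is proved for no curve by any of this.
References: [JetchevSkinnerWan2017] §7.4.1 (arXiv:1512.06894 p. 30); [CastellaLiuWan2022] Thm. 8.2.1 (1), §6.1; [Hsieh2014] Thm. B; [LiuZhangZhang2018]
Thm. 1.5.1/1.5.3; [CaiShuTian2014] Thm. 1.1; [HoffsteinLuo1997] Theorem (§1); [SkinnerUrban2014] Thm. 3.6.4.
-/

set_option autoImplicit false
set_option linter.dupNamespace false

noncomputable section

open scoped Classical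
open NumberField IsDedekindDomain IsDedekindDomain.HeightOneSpectrum Rat.HeightOneSpectrum
open WeierstrassCurve Literature.NumberTheory.EllipticCurves
open Literature.NumberTheory.EllipticCurves.Rank1Residual
open Literature.NumberTheory.QuadraticFields
open Summit.BirchSwinnertonDyer.Rank1Residual
open Summit.BirchSwinnertonDyer.Rank1Residual.Additive
open Summit.BirchSwinnertonDyer.BirchSwinnertonDyer.Theorems
open ThreeFieldRoadSupply

namespace Summit.BirchSwinnertonDyer.BirchSwinnertonDyer.Theorems.WanAnyRoad

/-! ### §6 Read (R1) DISCHARGED: the ♭-inclusion chain over `TameRoadFieldAny` (p761092 §`TwistRowClosed` re-keyed; ONE chain for every Wan prime) -/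

section FlatChain

open Literature.NumberTheory.EllipticCurves.ModularForms Literature.NumberTheory.EllipticCurves.Rank1Residual.Typed Field

/-- THE TWO-VARIABLE DIVISIBILITY AWAY FROM THE CYCLOTOMIC VARIABLE WITH ITS ANTICYCLOTOMIC RESTRICTION AT A ROAD FIELD WHOSE WAN PRIME HAS ANY
PARITY (`TameRoadFieldAny`; p761092-side `TwistRowClosed.awayFromCyc_twistAny` re-keyed, the partner chosen by the parity of `q`), for a curve of cell (G-ord,
`e = 2`) with `p ≥ 5`, `ρ̄` onto, additive primes (`2` included) of quadratic-twist type, at a tame-road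
field `K`: for every parametrisation `Dt` of level `N_E`, anticyclotomic `(κ, γ)`, degree-one `𝔭 ∣ p`, `𝔭′ ≠ 𝔭` over `p`, embedding datum
`ι′` inducing `𝔭`, `X_ac^∅(E_K)_{𝔭′}` `Λ`-torsion and every completing pair `(κ₁, γ₁)`, a two-variable fraction `A/B` with `B(0,·) ≠ 0`, a
non-zero `h` in the cyclotomic variable alone, a ♭-frame `(Ω_K′, Ω_p′, Q′)` and the restriction `D` with `h·B·ch_{Λ₂}(X_Gr₂)·Λ^ur ⊆ (A)`,
`A(0,·) = B(0,·)·D`, `D ≠ 0`, `(D) ⊆ (Q′)`. Proof: `ThreeFieldRowClosed.awayFromCyc_tameRoadRow` verbatim with the SEMISTABLE partner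
`V₀ ≅ E^{(p*·d)}` (`TwistTypePartnerData.exists_semistable_partner_data_two`; the primes of `d` divide `N_E`, are `≠ q`, hence split in `K`; `2` splits in `K`) and
print Thm. 8.2.1 ∘ JSW 6.1.6 in the DYADIC semistable-twist reading (`h821`) at the pair of `h61`; hypothesis (T) from
`TameXGr₂Torsion.isTorsion_XGr₂_cellGordTwo`, clause (ii) from `TameAnticycRestriction.exists_frame_and_restriction` (Hsieh Thm. B frame).
[cite: CastellaLiuWan2022, Thm. 8.2.1 (p. 85) and §6.1 (p. 51) (Forum Math. Sigma 10 (2022) e110)]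
[cite: JetchevSkinnerWan2017, Thm. 6.1.6 (arXiv:1512.06894 p. 26)] [cite: Hsieh2014, Thm. B (Doc. Math. 19 p. 712)] -/
theorem awayFromCyc_wanAny (hmodP : nonempty_modularParametrizationData)
    (hB : Hsieh2014.thmB_exists_isHsiehLFunction_coeff_norm_eq_one_unrPeriod_ramifiedSteinberg)
    (h821 : CastellaLiuWan2022.thm821_XGr₂_charIdeal_mul_le_awayFromCyc_semistableTwistDyadic)
    (h61 : CastellaLiuWan2022.sec61_exists_isCastellaLiuWanLFunction₂_semistableTwistDyadic)
    (W : WeierstrassCurve ℚ) [W.IsElliptic] [W.IsGloballyMinimal] (p : ℕ) [Fact p.Prime]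
    (K : Type) [Field K] [NumberField K]
    (hcell : N10.CellGordTwo W p) (hp5 : 5 ≤ p) (hsurj : Surj W p)
    (h2tt : ∀ r : Nat.Primes, (r : ℕ) = 2 → W.HasAdditiveReductionAt ((primesEquiv (R := ℤ)).symm r) →
      ∃ t : ℤ, (t = -1 ∨ t = 2 ∨ t = -2) ∧ ¬ (W.quadraticTwist (t : ℚ)).HasAdditiveReductionAt ((primesEquiv (R := ℤ)).symm r))
    (htt : ∀ r : Nat.Primes, (r : ℕ) ≠ 2 → W.HasAdditiveReductionAt ((primesEquiv (R := ℤ)).symm r) →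
      ¬ (W.quadraticTwist (((-1 : ℤ) ^ ((r : ℕ) / 2) * r : ℤ) : ℚ)).HasAdditiveReductionAt
        ((primesEquiv (R := ℤ)).symm r))
    (hK : TameRoadFieldAny W p K) :
    ∀ (N : ℕ) [NeZero N] (Dt : ModularParametrizationData W N), W.conductorNorm ℤ = N →
    ∀ (κ : ZpExtension K p), κ.IsAnticyclotomic → ∀ (γ : Field.absoluteGaloisGroup K) [Fact (κ.IsTopGenerator γ)]
      (𝔭 : HeightOneSpectrum (𝓞 K)), ((p : ℕ) : 𝓞 K) ∈ 𝔭.asIdeal → 𝔭.asIdeal.ramificationIdx (𝓞 ℚ) = 1 →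
      𝔭.asIdeal.inertiaDeg (𝓞 ℚ) = 1 → ∀ (𝔭' : HeightOneSpectrum (𝓞 K)), ((p : ℕ) : 𝓞 K) ∈ 𝔭'.asIdeal → 𝔭' ≠ 𝔭 →
      ∀ (ι' : PadicAlgCl p ≃+* ℂ), SchneiderFree.BranchInducesPrime p ι' 𝔭 →
        Module.IsTorsion (IwasawaAlgebra p) (X11b.AcSelmer.XAc (W.baseChange K) p κ 𝔭' ∅ γ) →
        ∀ (κ₁ : ZpExtension K p) (γ₁ : Field.absoluteGaloisGroup K) [Fact (ZpExtension.IsTopGeneratorPair κ₁ κ γ₁ γ)],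
          ∃ (A B : PowerSeries (PowerSeries (PadicComplexInt p))) (h : PowerSeries (PadicComplexInt p))
            (ΩK' : ℂ) (Ωp' : ℂ_[p]) (Q' D : PowerSeries (PadicComplexInt p)),
            h ≠ 0 ∧ ΩK' ≠ 0 ∧ Ωp' ≠ 0 ∧ X11b.R1.IsBDPLFunctionInt p ι' 𝔭 κ γ Dt.f ΩK' Ωp' Q' ∧
            (∀ y ∈ (WeierstrassCurve.XGr₂.charIdeal (W.baseChange K) p κ₁ κ 𝔭' γ₁ γ).map
                (IwasawaAlgebra₂.toUnr₂ p (X11b.R1.toCpInt p)),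
              PowerSeries.map (PowerSeries.C : PadicComplexInt p →+* PowerSeries (PadicComplexInt p)) h * B * y ∈
                Ideal.span {A}) ∧
            PowerSeries.constantCoeff B ≠ 0 ∧ PowerSeries.constantCoeff A = PowerSeries.constantCoeff B * D ∧
            D ≠ 0 ∧ Ideal.span {D} ≤ Ideal.span {Q'} := by
  intro N _ Dt hN κ hκ γ hγ 𝔭 h𝔭 _ _ 𝔭' h𝔭' hne ι' hind htors κ₁ γ₁ hpair
  have hp2 : p ≠ 2 := by omega
  have hmod : exists_isNewformOf := exists_isNewformOf_of_nonempty_modularParametrizationData hmodP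
  -- the field data (Wan prime `q` of ANY parity; `d_K < -4` is a field of the predicate and is not needed here)
  obtain ⟨hKiq, -, ⟨q, hqF, hWan, hqd, hsplitq⟩, h2K, hpK⟩ := hK
  haveI := hqF
  obtain ⟨hqp, hmq, hns, hram⟩ := hWan
  have hK2 : Module.finrank ℚ K = 2 := hKiq.1
  have hpsplit : ((Ideal.span {(p : ℤ)}).primesOver (𝓞 K)).ncard = 2 := hpK p Fact.out (dvd_refl p)
  -- the SEMISTABLE partner `V₀ ≅ E^{(p*·d)}` and CLW's two binders at `2`, BY THE PARITY OF THE WAN PRIME (read (R1)):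
  -- `q = 2`: `E` is multiplicative at `2`, so no additive place above `2` and the ODD partner (`d ≡ 1 (mod 4)`) serves —
  -- CLW's `hd4` is vacuous and `h2V` is `q ∣ N_V`; `q` odd: verbatim p761092 (`2` splits in `K`).
  obtain ⟨V, iV, iVm, C, d, hCV, hpd, hdpr, hsq, hpN, hsurjV, hqN, hd4, h2V⟩ :
      ∃ (V : WeierstrassCurve ℚ) (_ : V.IsElliptic) (_ : V.IsGloballyMinimal) (C : VariableChange ℚ) (d : ℤ),
        C • W.quadraticTwist ((-1 : ℚ) ^ (p / 2) * p * d) = V ∧ ¬ (p : ℤ) ∣ d ∧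
        (∀ ℓ : ℕ, ℓ.Prime → (ℓ : ℤ) ∣ d → ℓ ∣ W.conductorNorm ℤ ∧ ℓ ≠ q) ∧
        Squarefree (V.conductorNorm ℤ) ∧ ¬ p ∣ V.conductorNorm ℤ ∧ Surj V p ∧ q ∣ V.conductorNorm ℤ ∧
        (d % 4 ≠ 1 → ((Ideal.span {(2 : ℤ)}).primesOver (𝓞 K)).ncard = 2) ∧
        (((Ideal.span {(2 : ℤ)}).primesOver (𝓞 K)).ncard ≠ 2 → 2 ∣ V.conductorNorm ℤ) := by
    by_cases hq2 : q = 2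
    · subst hq2
      have h2 := two_lt_ringChar_of_mult_two W hmq
      obtain ⟨V, iV, iVm, C, d, hCV, hd41, hpd, hdpr, hsq, hpN, hsurjV, hqN, -⟩ :=
        TwistTypePartnerData.exists_semistable_partner_data_odd W p hp5 hcell hsurj h2 htt hqp hmq
      exact ⟨V, iV, iVm, C, d, hCV, hpd, hdpr, hsq, hpN, hsurjV, hqN, fun h ↦ absurd hd41 h, fun _ ↦ hqN⟩
    · obtain ⟨V, iV, iVm, C, d, hCV, hpd, hdpr, hsq, hpN, hsurjV, hqN⟩ :=
        TwistTypePartnerData.exists_semistable_partner_data_two W p hp5 hcell hsurj h2tt htt hqp hmq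
      -- `2` splits in the road field (a bad prime `≠ q` splits; `2` splits also when `2 ∤ N_E`)
      have h2split : ((Ideal.span {(2 : ℤ)}).primesOver (𝓞 K)).ncard = 2 := by
        by_cases h2N : 2 ∣ W.conductorNorm ℤ
        · exact hsplitq 2 Nat.prime_two h2N (fun h ↦ hq2 h.symm)
        · exact h2K h2N
      exact ⟨V, iV, iVm, C, d, hCV, hpd, hdpr, hsq, hpN, hsurjV, hqN, fun _ ↦ h2split,
        fun hne2 ↦ absurd h2split hne2⟩
  haveI := iV
  haveI := iVm
  have hVW : ∃ C' : WeierstrassCurve.VariableChange ℚ, C' • W.quadraticTwist ((-1 : ℚ) ^ (p / 2) * p * d) = V :=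
    ⟨C, hCV⟩
  -- the primes of `d` divide `N_E` and are `≠ q`, hence split in `K`
  have hsplitd : ∀ ℓ : ℕ, ℓ.Prime → (ℓ : ℤ) ∣ d → ((Ideal.span {(ℓ : ℤ)}).primesOver (𝓞 K)).ncard = 2 :=
    fun ℓ hℓ hℓd ↦ hsplitq ℓ hℓ (hdpr ℓ hℓ hℓd).1 (hdpr ℓ hℓ hℓd).2
  have hNW : ((N : ℕ) : ℤ) = (W.conductorNorm ℤ : ℤ) := by rw [hN]
  have hq' : ∃ q : ℕ, q.Prime ∧ q ∣ V.conductorNorm ℤ ∧ ((Ideal.span {(q : ℤ)}).primesOver (𝓞 K)).ncard ≠ 2 :=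
    ⟨q, hqF.out, hqN, Hsieh2014.ncard_primesOver_ne_two_of_dvd_discr K hK2 hqF.out hqd⟩
  have hirr : (V.baseChange K).HasIrreducibleModPGaloisRep p := irrK_of_surj V p hsurjV K hK2
  -- existence of CLW's imprimitive two-variable `L`-function as a pair `(A, C(p^k)·B)`
  obtain ⟨Ωinf, Cc, Ωp, S, k, A, B, hΩinf, hCc, -, -, hCLW, hB0⟩ :=
    h61 ι' V W K 𝔭 𝔭' κ₁ κ γ₁ γ Dt.isNewformOf (V.conductorNorm ℤ) d hVW hd4 hpd hsplitd hNW rfl hp2 hsq hpN hKiq hpsplit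
      h𝔭 h𝔭' hne hind hq' h2V hirr hκ
  set B' : PowerSeries (PowerSeries (PadicComplexInt p)) :=
    PowerSeries.C (PowerSeries.C (((p : ℕ) : PadicComplexInt p) ^ k)) * B with hB'
  have hB'0 : PowerSeries.constantCoeff B' ≠ 0 := by
    rw [hB', map_mul, PowerSeries.constantCoeff_C]
    refine mul_ne_zero ?_ hB0
    rw [Ne, PowerSeries.ext_iff, not_forall]
    refine ⟨0, ?_⟩
    rw [PowerSeries.coeff_C, if_pos rfl, map_zero]
    exact pow_ne_zero _ (by exact_mod_cast (Fact.out : p.Prime).ne_zero)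
  -- (T): torsion of `X_Gr₂` (p714502)
  have hXtors : Module.IsTorsion (IwasawaAlgebra₂ p) ((W.baseChange K).XGr₂ p κ₁ κ 𝔭' γ₁ γ) :=
    TameXGr₂Torsion.isTorsion_XGr₂_cellGordTwo W p K hcell hp5 hsurj hKiq hpsplit κ₁ κ γ₁ γ 𝔭' h𝔭' htors
  -- (i): print Thm. 8.2.1 ∘ JSW 6.1.6 (semistable-twist reading) at the pair `(A, B′)`
  obtain ⟨h, hh, hincl⟩ :=
    h821 ι' V W K 𝔭 𝔭' κ₁ κ γ₁ γ Dt.isNewformOf (V.conductorNorm ℤ) d hVW hd4 hpd hsplitd hNW rfl hp2 hsq hpN hKiq hpsplit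
      h𝔭 h𝔭' hne hind hq' h2V hirr hκ hXtors Ωinf Cc Ωp A B' hΩinf hCc hCLW (X11b.R1.toCpInt p)
      (fun x ↦ X11b.R1.coe_toCpInt p x)
  -- (ii): the anticyclotomic restriction (p715340)
  obtain ⟨ΩK', Ωp', Q', D, hΩK', hΩp', hQ', hAB, hD0, hDQ'⟩ :=
    TameAnticycRestriction.exists_frame_and_restriction hB W p K hp5 hcell.2.1 hsurj hKiq hpsplit hqp hqd hmq
      hns hsplitq Dt hN κ hκ γ 𝔭 h𝔭 𝔭' ι' hind κ₁ γ₁ Ωinf Cc Ωp A B' hΩinf hCc hCLW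
  exact ⟨A, B', h, ΩK', Ωp', Q', D, hh, hΩK', hΩp', hQ', hincl, hB'0, hAB, hD0, hDQ'⟩

/-- THE ANTICYCLOTOMIC SPECIALISATION OF THE TWO-VARIABLE GREENBERG CHARACTERISTIC IDEAL LIES IN THE ♭-FRAME'S IDEAL (road field over a Wan prime of
ANY parity; `TwistRowClosed.greenbergInclusion_twistAny` re-keyed verbatim), for a curve of
cell (G-ord, `e = 2`) with `p ≥ 5`, `ρ̄` onto and additive primes `ℓ ≠ p` (`2` included) of quadratic-twist type, at a tame-road field: for every ♭-datum
with a ♭-frame `Q` and every completing pair there is `k` with `C(p^k)·w ∈ (Q)` for every `w` in the specialisation `T₁ ↦ 0` of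
`ch_{Λ₂}(X_Gr₂(E_K)_{𝔭′})·Λ^ur`. Proof: `awayFromCyc_wanAny`; `(Q′) = (Q)` by ideal rigidity across ♭-frames
(`X11b.R1.span_singleton_eq_of_isBDPLFunctionInt`); the `T₁`-cancellation `TameAwayFromCyc.exists_C_pow_mul_mem_span_of_frac`
(verbatim `TwistOddRowClosed.greenbergInclusion_twistOdd`).
[cite: CastellaLiuWan2022, Thm. 8.2.1 (p. 85) (Forum Math. Sigma 10 (2022) e110)] [cite: Wan2020RankinSelbergIMC, §7.5 (arXiv:1408.4044v5)] -/
theorem greenbergInclusion_wanAny (hmodP : nonempty_modularParametrizationData)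
    (hB : Hsieh2014.thmB_exists_isHsiehLFunction_coeff_norm_eq_one_unrPeriod_ramifiedSteinberg)
    (h821 : CastellaLiuWan2022.thm821_XGr₂_charIdeal_mul_le_awayFromCyc_semistableTwistDyadic)
    (h61 : CastellaLiuWan2022.sec61_exists_isCastellaLiuWanLFunction₂_semistableTwistDyadic)
    (W : WeierstrassCurve ℚ) [W.IsElliptic] [W.IsGloballyMinimal] (p : ℕ) [Fact p.Prime]
    (K : Type) [Field K] [NumberField K]
    (hcell : N10.CellGordTwo W p) (hp5 : 5 ≤ p) (hsurj : Surj W p)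
    (h2tt : ∀ r : Nat.Primes, (r : ℕ) = 2 → W.HasAdditiveReductionAt ((primesEquiv (R := ℤ)).symm r) →
      ∃ t : ℤ, (t = -1 ∨ t = 2 ∨ t = -2) ∧ ¬ (W.quadraticTwist (t : ℚ)).HasAdditiveReductionAt ((primesEquiv (R := ℤ)).symm r))
    (htt : ∀ r : Nat.Primes, (r : ℕ) ≠ 2 → W.HasAdditiveReductionAt ((primesEquiv (R := ℤ)).symm r) →
      ¬ (W.quadraticTwist (((-1 : ℤ) ^ ((r : ℕ) / 2) * r : ℤ) : ℚ)).HasAdditiveReductionAt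
        ((primesEquiv (R := ℤ)).symm r))
    (hK : TameRoadFieldAny W p K) :
    ∀ (N : ℕ) [NeZero N] (Dt : ModularParametrizationData W N), W.conductorNorm ℤ = N →
    ∀ (κ : ZpExtension K p), κ.IsAnticyclotomic → ∀ (γ : Field.absoluteGaloisGroup K) [Fact (κ.IsTopGenerator γ)]
      (𝔭 : HeightOneSpectrum (𝓞 K)), ((p : ℕ) : 𝓞 K) ∈ 𝔭.asIdeal → 𝔭.asIdeal.ramificationIdx (𝓞 ℚ) = 1 →
      𝔭.asIdeal.inertiaDeg (𝓞 ℚ) = 1 → ∀ (𝔭' : HeightOneSpectrum (𝓞 K)), ((p : ℕ) : 𝓞 K) ∈ 𝔭'.asIdeal → 𝔭' ≠ 𝔭 →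
      ∀ (ι' : PadicAlgCl p ≃+* ℂ), SchneiderFree.BranchInducesPrime p ι' 𝔭 →
      ∀ (ΩK : ℂ) (Ωp : ℂ_[p]) (Q : PowerSeries (PadicComplexInt p)), ΩK ≠ 0 → Ωp ≠ 0 →
        X11b.R1.IsBDPLFunctionInt p ι' 𝔭 κ γ Dt.f ΩK Ωp Q →
        Module.IsTorsion (IwasawaAlgebra p) (X11b.AcSelmer.XAc (W.baseChange K) p κ 𝔭' ∅ γ) →
        ∀ (κ₁ : ZpExtension K p) (γ₁ : Field.absoluteGaloisGroup K) [Fact (ZpExtension.IsTopGeneratorPair κ₁ κ γ₁ γ)],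
          ∃ k : ℕ,
            ∀ w ∈ ((WeierstrassCurve.XGr₂.charIdeal (W.baseChange K) p κ₁ κ 𝔭' γ₁ γ).map
                (IwasawaAlgebra₂.toUnr₂ p (X11b.R1.toCpInt p))).map
                (PowerSeries.constantCoeff (R := PowerSeries (PadicComplexInt p))),
              PowerSeries.C (((p : ℕ) : PadicComplexInt p) ^ k) * w ∈ Ideal.span {Q} := by
  intro N _ Dt hN κ hκ γ hγ 𝔭 h𝔭 he hf 𝔭' h𝔭' hne ι' hind ΩK Ωp Q hΩK hΩp hBDP htors κ₁ γ₁ hpair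
  obtain ⟨A, B, h, ΩK', Ωp', Q', D, hh, hΩK', hΩp', hQ', hincl, hB0, hAB, hD0, hDQ'⟩ :=
    awayFromCyc_wanAny hmodP hB h821 h61 W p K hcell hp5 hsurj h2tt htt hK N Dt hN κ hκ γ 𝔭 h𝔭 he hf 𝔭' h𝔭' hne ι' hind
      htors κ₁ γ₁
  have hp2 : p ≠ 2 := by omega
  -- `(Q′) = (Q)`: ideal rigidity across ♭-frames
  have hQQ' : Ideal.span ({Q'} : Set (PowerSeries (PadicComplexInt p))) = Ideal.span {Q} :=
    X11b.R1.span_singleton_eq_of_isBDPLFunctionInt hp2 hK.1 hκ hγ.out hΩK hΩK' hΩp hΩp' hBDP hQ'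
  obtain ⟨k, hk⟩ := TameAwayFromCyc.exists_C_pow_mul_mem_span_of_frac _ A B D hB0 hD0 hAB h hh hincl
  refine ⟨k, fun w hw ↦ ?_⟩
  rw [← hQQ']
  exact hDQ' (hk w hw)

/-- THE ♭-INCLUSION FOR UNIT-CONTENT FRAMES AT TORSION DATA (road field over a Wan prime of ANY parity; `TwistRowClosed.flatInclusion_twistAny`
re-keyed verbatim: the Heegner clause is now the predicate's fifth field), for a curve of cell (G-ord, `e = 2`) with `p ≥ 5`, `ρ̄` onto and odd additive
primes `ℓ ≠ p` of quadratic-twist type, at a tame-road field: `Ch_Λ(X_ac^∅(E_K)_{𝔭′})·𝓞_{ℂ_p}⟦T⟧ ⊆ (Q)` for every unit-content ♭-frame `Q`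
at `Λ`-torsion data. Proof: verbatim `ThreeFieldRowClosed.flatInclusion_tameRoadRow` — `E(K)[p] = 0`, a completing generator pair, the tame
local vanishing (`TameLocalVanishing.tameLocalVanishing_cellGordTwo`) and tame exact control (`TameExactControl.tameExactControl_of_localVanishing`),
`greenbergInclusion_wanAny` at that pair, then `TameSpecialization.S2L.charIdeal_XAc_map_le_span_of_twoVarSpec`.
[cite: JetchevSkinnerWan2017, §3.4 Lemma 3.4.1 and Thm. 6.1.4–6.1.5 (arXiv:1512.06894 pp. 14–15, 26)]
[cite: SkinnerUrban2014, Prop. 3.2.8 (p. 23)] -/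
theorem flatInclusion_wanAny (hmodP : nonempty_modularParametrizationData)
    (hB : Hsieh2014.thmB_exists_isHsiehLFunction_coeff_norm_eq_one_unrPeriod_ramifiedSteinberg)
    (h821 : CastellaLiuWan2022.thm821_XGr₂_charIdeal_mul_le_awayFromCyc_semistableTwistDyadic)
    (h61 : CastellaLiuWan2022.sec61_exists_isCastellaLiuWanLFunction₂_semistableTwistDyadic)
    (W : WeierstrassCurve ℚ) [W.IsElliptic] [W.IsGloballyMinimal] (p : ℕ) [Fact p.Prime]
    (K : Type) [Field K] [NumberField K]
    (hcell : N10.CellGordTwo W p) (hp5 : 5 ≤ p) (hsurj : Surj W p)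
    (h2tt : ∀ r : Nat.Primes, (r : ℕ) = 2 → W.HasAdditiveReductionAt ((primesEquiv (R := ℤ)).symm r) →
      ∃ t : ℤ, (t = -1 ∨ t = 2 ∨ t = -2) ∧ ¬ (W.quadraticTwist (t : ℚ)).HasAdditiveReductionAt ((primesEquiv (R := ℤ)).symm r))
    (htt : ∀ r : Nat.Primes, (r : ℕ) ≠ 2 → W.HasAdditiveReductionAt ((primesEquiv (R := ℤ)).symm r) →
      ¬ (W.quadraticTwist (((-1 : ℤ) ^ ((r : ℕ) / 2) * r : ℤ) : ℚ)).HasAdditiveReductionAt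
        ((primesEquiv (R := ℤ)).symm r))
    (hK : TameRoadFieldAny W p K) :
    ∀ (N : ℕ) [NeZero N] (Dt : ModularParametrizationData W N), W.conductorNorm ℤ = N →
    ∀ (κ : ZpExtension K p), κ.IsAnticyclotomic → ∀ (γ : Field.absoluteGaloisGroup K) [Fact (κ.IsTopGenerator γ)]
      (𝔭 : HeightOneSpectrum (𝓞 K)), ((p : ℕ) : 𝓞 K) ∈ 𝔭.asIdeal → 𝔭.asIdeal.ramificationIdx (𝓞 ℚ) = 1 →
      𝔭.asIdeal.inertiaDeg (𝓞 ℚ) = 1 → ∀ (𝔭' : HeightOneSpectrum (𝓞 K)), ((p : ℕ) : 𝓞 K) ∈ 𝔭'.asIdeal → 𝔭' ≠ 𝔭 →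
      ∀ (ι' : PadicAlgCl p ≃+* ℂ), SchneiderFree.BranchInducesPrime p ι' 𝔭 →
      ∀ (ΩK : ℂ) (Ωp : ℂ_[p]) (Q : PowerSeries (PadicComplexInt p)), ΩK ≠ 0 → Ωp ≠ 0 →
        X11b.R1.IsBDPLFunctionInt p ι' 𝔭 κ γ Dt.f ΩK Ωp Q →
        Module.IsTorsion (IwasawaAlgebra p) (X11b.AcSelmer.XAc (W.baseChange K) p κ 𝔭' ∅ γ) →
        GreenbergVatsal2000.HasUnitContent Q →
        (X11b.AcSelmer.XAc.charIdeal (W.baseChange K) p κ 𝔭' ∅ γ).map (PowerSeries.map (X11b.R1.toCpInt p)) ≤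
          Ideal.span {Q} := by
  intro N _ Dt hN κ hκ γ hγ 𝔭 h𝔭 he hf 𝔭' h𝔭' hne ι' hind ΩK Ωp Q hΩK hΩp hBDP htors hμ
  have hp : p.Prime := Fact.out
  have hp2 : p ≠ 2 := by omega
  haveI hEK : (W.baseChange K).IsElliptic := by rw [baseChange]; infer_instance
  -- `E(K)[p] = 0`
  have htor := Literature.NumberTheory.EllipticCurves.torsionBy_eq_bot_of_isImaginaryQuadratic W K hK.1 hp hp2 hsurj
  have hKp : ∀ P : (W.baseChange K).toAffine.Point, p • P = 0 → P = 0 := fun P hP => by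
    have hmem : P ∈ AddSubgroup.torsionBy (W.baseChange K).toAffine.Point (p : ℤ) :=
      AddSubgroup.torsionBy.nsmul_iff.mpr hP
    rw [htor] at hmem
    exact AddSubgroup.mem_bot.mp hmem
  -- the completing pair, tame local vanishing and tame exact control
  obtain ⟨κ₁, γ₁, hpair⟩ := TameGeneratorPair.exists_isTopGeneratorPair_of_isImaginaryQuadratic hK.1 κ γ hγ.out
  haveI hpairI : Fact (ZpExtension.IsTopGeneratorPair κ₁ κ γ₁ γ) := ⟨hpair⟩
  have hvan : ∀ m : (W.baseChange K).geomPrimaryTorsion p,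
      (∀ x : Field.absoluteGaloisGroup K, x ∈ ZpExtension.pairKer κ₁ κ → x ∈ GreenbergSelmer.inertia 𝔭' → x • m = m) →
        m = 0 := fun m hm =>
    TameLocalVanishing.tameLocalVanishing_cellGordTwo W p K hcell hp5 hK.1.1 (hK.2.2.2.2 p Fact.out (dvd_refl p))
      κ₁ κ 𝔭' h𝔭' m hm
  obtain ⟨m, hm⟩ :=
    TameExactControl.tameExactControl_of_localVanishing W p hp2 hsurj K hK.1 κ₁ κ γ₁ γ 𝔭' h𝔭' hvan
  -- the two-variable specialised inclusion at that pair, then the proved specialisation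
  have h2 := greenbergInclusion_wanAny hmodP hB h821 h61 W p K hcell hp5 hsurj h2tt htt hK N Dt hN κ hκ γ 𝔭 h𝔭 he hf 𝔭'
    h𝔭' hne ι' hind ΩK Ωp Q hΩK hΩp hBDP htors κ₁ γ₁
  exact TameSpecialization.S2L.charIdeal_XAc_map_le_span_of_twoVarSpec (W.baseChange K) p κ₁ κ 𝔭' γ₁ γ hKp htors ⟨m, hm⟩
    (X11b.R1.toCpInt p) Q hμ h2

end FlatChain

end Summit.BirchSwinnertonDyer.BirchSwinnertonDyer.Theorems.WanAnyRoad

end
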